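import Literature.MathematicalPhysics.QuantumFieldTheory.Balaban1983to89.B8Ineq159FlatCubeMemberPrinted
import Literature.MathematicalPhysics.QuantumFieldTheory.Balaban1983to89.B8Eq12HodgeLaplacianV1
import Literature.MathematicalPhysics.QuantumFieldTheory.Balaban1983to89.B6GradLegKLevelV1
import Literature.MathematicalPhysics.QuantumFieldTheory.Balaban1983to89.B6GlobalChartV1

/-!
# `Balaban1983to89.B8CubeMemberTorusChart` — TRANSPLANT STEP T2b of the N05 flat road: THE ADDITIVE CHART `ℤ^{d+1} → T_η` OF THE V1 TORUS AND THE
# FLAT OPERATOR DICTIONARY `D^η_1 ↔ ∇`, `D^η_1A(p) ↔ ∂A(p)`, `J = D^{η*}_1D^η_1 ↔ ∂*∂`, `Δ^η_1 ↔ Δ` FOR FIELDS SUPPORTED DEEP INSIDE THE FUNDAMENTAL BOX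
# ([Balaban1985RegularSpaces] (1.1)–(1.2) p. 76, (1.55) p. 86; [Balaban1984PropagatorsI] (1.2), (1.4), (1.21) pp. 18–21; [Balaban1984PropagatorsII] (2.19) p. 226)

statement-level skeleton of published theorems with citation tags; proofs where landed; nothing here is a claim about the
Yang–Mills mass gap

PDF held: `paper:balaban1985-cmp99-regular-spaces-gauge-fixing` (journal page = PDF page + 74): (1.1)–(1.2) p. 76 (the covariant derivatives of site,
bond and plaquette functions), (1.55) p. 86 («D^{η*}_{U₀}D^η_{U₀}A = J»); `[Balaban1984PropagatorsI]` (1.2)/(1.4) p. 18, (1.21) p. 21; `[Balaban1984PropagatorsII]`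
(2.19) p. 226 («Δ_a = ∂*∂ + ∂R∂* + Q*aQ»); `[Balaban1983RegularityDecay]` p. 572 (T_η with periodic conditions).

CITATION HEADER (lean-in-tree rule).  Cell `pub-ymgap` (YM Track A, HUMAN RULING D-0062), DAG node N05 = [B8], seat `pub-ymgap-dag-n05-c` (g12), the seat's
`TRANSPLANT-DESIGN.md` step T2b.  WHY THIS FILE.  The discharge road of `B8Ineq159FlatCubeMemberPrinted.Ineq159FlatCubeMemberPrinted` ([4] Thm 3.3 at `U = 1` on the
Dirichlet cube member of (1.131), carriers `Site (d+1) = ℤ^{d+1}`, operators `B8Ineq132.covDerivFwd`, `B8Eq146AExpansion.plaqCovDeriv`, `B8Eq155JBound.Jcur`,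
`B8Eq138LandauZd.covLap` at the flat background) transplants the member's field to the V1 torus `T_η = Site (PV d ℓ m K) 0` of `B6GlobalChartV1` (operators
`B6GradLegKLevelV1.DV`, `B6SectAOperatorsV1.dcE`/`dcsE`, `LatticeFieldCalculus.laplace` with lattice factor `c = η⁻¹`), where lit-balaban's level-0 twin of the
`k`-level (1.59) reading (sub-row G-F3′-L0∕B8, ME #33) applies.  THIS FILE is the chart and the operator dictionary: §1 the ADDITIVE chart `toTorus : ℤ^{d+1} → T_η`
(coordinatewise reduction), inverse to the label chart `B6GlobalChartV1.toBox` on the fundamental box, carrying `+e_μ` to `Site.shift` and `−e_μ` to `Site.unshift`;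
§2 fields on `ℤ^{d+1}` supported `r`-DEEP inside the fundamental box (`DeepSupp`), their lifts to torus bond functions through a real-linear functional
`g : ℂ →ₗ[ℝ] ℝ` (`g = re, im`: the torus calculus is real, the member's field complex) and THE MASTER TRANSLATION LEMMA: for such a field, evaluating at the torus
translate of a site by a vector of sup-size `≤ r` is evaluating at the translated label vector (wrap-arounds land outside the support); §3 the four identities.

WHAT THIS FILE PROVES (kernel-checked; `P₀ = PV d ℓ m K`, period `N = 2L^{m+K}`).
* §1 `toTorus`, `labels` (= the coordinates of `toBox`, `labels_eq_toBox`), `toTorus_labels`, `labels_toTorus` (on the box), `toTorus_add_e`∕`toTorus_sub_e` (`±e_μ ↦ shift∕unshift`),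
  `labels_nonneg`, `labels_lt`.
* §2 `DeepSupp N r f` (`f z ≠ 0 ⇒ r ≤ z_μ ∧ z_μ + r < N`), `DeepSupp.mono`, ★ `apply_labels_toTorus_add` (the master lemma), `apply_labels_shift`∕`apply_labels_unshift`
  (one step), `liftB g φ` (`b ↦ g(φ(labels b₋, dir b))`), `liftS g f`.
* §3 ★ `DV_liftB` (`(∇_ν liftB)(⟨x, τ⟩) = g((D^η_{1,ν}φ_τ)(labels x))`), ★ `curl_liftB` (`(∂ liftB)(p_{μν}(x)) = g((D^η_1φ)(p_{μν}(labels x)))`),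
  ★★ `dcsE_dcE_liftB` (`(∂*∂ liftB)(⟨x, μ⟩) = g(J(φ)_μ(labels x))`, (1.2)∘(3.4) = `B8Eq12HodgeLaplacianV1.dcsE_apply` ∘ `dcE_apply` vs `pdiv` ∘ `plaqCovDeriv`),
  ★ `laplace_liftB` (`(Δ liftB_τ)(x) = g((Δ^η_1φ_τ)(labels x))`), ★ `diverg_liftB` (`(∂* liftB)(x) = g((D^{η*}_1φ)(labels x))`), `laplace_liftS` (site functions) — all for
  fields supported `1`-deep (`2`-deep for `∂*∂`), `c = η⁻¹`.

HONEST SCOPE ∕ NOT CLAIMED.  Bookkeeping (finite-difference stencils under an additive chart); no estimate; the averaging operators (`QE` ↔ `linCovIter`), the constraint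
classes (`LamBond` ↔ `cubeLamBP`) and the Landau condition (`RE … = 0` ↔ `IsLandau138`) are the next files (T3a∕T3b).  Count-neutral; N05 NOT discharged; one finite `T⁴`
programme at fixed `ε`, Bałaban as printed; nothing continuum ∕ ℝ⁴ ∕ OS ∕ mass-gap ∕ Clay.  No `sorry`, no `instance`, no `notation`; `def`s: `toTorus`, `labels`, `DeepSupp`,
`liftB`, `liftS` (plumbing).  Unit `pub-ymgap-dag-n05-c` (g12), 2026-08-27.

RELATED IN THE TREE, NOT DUPLICATED (`rg` 2026-08-27T23:40Z): `B6GlobalChartV1.toBox`∕`boxEquiv` (r03; the label chart `T_η → box` — `labels` is its coordinate map, USED),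
`B6TorusDepthDistance.SiteDeep` (r03; deepness of a SITE — `DeepSupp` is the support version for functions), `B8Eq191FlatStencils.*_flat_apply` (dag-n05-a∕-c lineage; USED),
`B8Eq12HodgeLaplacianV1.dcsE_apply` (r05; USED), `B6GradLegKLevelV1.DV_apply` (p38; USED).
-/
noncomputable section

namespace Literature.MathematicalPhysics.QuantumFieldTheory.Balaban1983to89.B8CubeMemberTorusChart

open B4Reflection242 (boxDom mem_boxDom)
open B6MultiLevelBoxOperator (N0)
open B6GlobalChartV1 (PV toBox toBox_apply)
open B7Prop1Explicit (e e_apply)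
open B8Ineq132 (covDerivFwd covDeriv)
open B8Eq146AExpansion (plaqCovDeriv)
open B8Eq155JBound (Jcur)
open B8Eq138LandauZd (covLap covDivB)
open B8Eq191FlatStencils (covDerivFwd_flat_apply covDeriv_flat_apply covLap_flat_apply)
open B6SectAOperatorsV1 (dcE dcsE dcE_apply)
open BalabanImbrieJaffe1984to88.BIJ85AxialPropagator411 (BondSpace PlaqSpace)
open B8Eq12HodgeLaplacianV1 (dcsE_apply)
open B6GradLegKLevelV1 (DV DV_apply)
open LatticeFieldCalculus (curl laplace pdiffAdj)

variable {d ℓ mV KV : ℕ} {hd : 1 ≤ d + 1} {hL : Odd (ℓ + 1) ∧ 1 < ℓ + 1}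

/-! ## §1 The additive chart `ℤ^{d+1} → T_η` and the label chart `T_η → ℤ^{d+1}` -/

section Chart

/-- **THE ADDITIVE CHART `ℤ^{d+1} → T_η`**: coordinatewise reduction modulo the period `N = 2L^{m+K}` (a group homomorphism in every coordinate, so every
finite-difference stencil of `ℤ^{d+1}` is carried to the torus stencil). [cite: Balaban1983RegularityDecay, p.572 (T_η with periodic conditions); Balaban1984PropagatorsII, (2.1) p.224, dictionary] -/
def toTorus (x : Fin (d + 1) → ℤ) : Site (PV d ℓ mV KV hd hL) 0 := fun μ => ((x μ : ℤ) : ZMod ((PV d ℓ mV KV hd hL).sitesPerDir 0))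

/-- **THE LABEL CHART `T_η → ℤ^{d+1}`**: the vector of labels in `[0, N)` — the coordinates of `B6GlobalChartV1.toBox`. [cite: Balaban1984PropagatorsII, (2.1) p.224, dictionary] -/
def labels (y : Site (PV d ℓ mV KV hd hL) 0) : Fin (d + 1) → ℤ := fun μ => ((y μ).val : ℤ)

/-- `labels` IS the coordinate map of `toBox` (`rfl`). [cite: Balaban1984PropagatorsII, (2.1) p.224, dictionary] -/
theorem labels_eq_toBox {Mh k : ℕ} {P' : Fin (d + 1) → ℕ} (hN : ∀ μ, N0 ℓ Mh k P' μ = (PV d ℓ mV KV hd hL).sitesPerDir 0)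
    (y : Site (PV d ℓ mV KV hd hL) 0) : labels y = (toBox hN y : Fin (d + 1) → ℤ) := rfl

/-- `toTorus (labels y) = y` (a site IS its labels). [cite: Balaban1984PropagatorsII, (2.1) p.224, dictionary] -/
theorem toTorus_labels (y : Site (PV d ℓ mV KV hd hL) 0) : toTorus (labels y) = y := by
  funext μ
  simp [toTorus, labels]

/-- `0 ≤ labels y μ`. [folklore] [cite: Balaban1984PropagatorsII, (2.1) p.224, dictionary] -/
theorem labels_nonneg (y : Site (PV d ℓ mV KV hd hL) 0) (μ : Fin (d + 1)) : 0 ≤ labels y μ := Nat.cast_nonneg _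

/-- `labels y μ < N`. [folklore] [cite: Balaban1984PropagatorsII, (2.1) p.224, dictionary] -/
theorem labels_lt (y : Site (PV d ℓ mV KV hd hL) 0) (μ : Fin (d + 1)) : labels y μ < ((PV d ℓ mV KV hd hL).sitesPerDir 0 : ℕ) := by
  show (((y μ).val : ℕ) : ℤ) < _
  exact_mod_cast ZMod.val_lt (y μ)

/-- `labels (toTorus x) μ = x μ mod N`. [folklore] [cite: Balaban1984PropagatorsII, (2.1) p.224, dictionary] -/
theorem labels_toTorus_apply (x : Fin (d + 1) → ℤ) (μ : Fin (d + 1)) :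
    labels (toTorus (hd := hd) (hL := hL) (mV := mV) (KV := KV) (ℓ := ℓ) x) μ = x μ % (((PV d ℓ mV KV hd hL).sitesPerDir 0 : ℕ) : ℤ) := by
  show ((((x μ : ℤ) : ZMod ((PV d ℓ mV KV hd hL).sitesPerDir 0))).val : ℤ) = _
  exact ZMod.val_intCast (x μ)

/-- **ON THE FUNDAMENTAL BOX THE TWO CHARTS ARE INVERSE**: `labels (toTorus x) = x` for `0 ≤ x_μ < N`. [cite: Balaban1984PropagatorsII, (2.1) p.224, dictionary] -/
theorem labels_toTorus {x : Fin (d + 1) → ℤ} (hx : ∀ μ, 0 ≤ x μ ∧ x μ < ((PV d ℓ mV KV hd hL).sitesPerDir 0 : ℕ)) :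
    labels (toTorus (hd := hd) (hL := hL) (mV := mV) (KV := KV) (ℓ := ℓ) x) = x := by
  funext μ
  rw [labels_toTorus_apply]
  exact Int.emod_eq_of_lt (hx μ).1 (hx μ).2

/-- **`+e_μ ↦ shift`**: `toTorus (x + e_μ) = (toTorus x).shift μ`. [cite: Balaban1984PropagatorsI, (1.2) p.18 («x + e_μ»), dictionary] -/
theorem toTorus_add_e (x : Fin (d + 1) → ℤ) (μ : Fin (d + 1)) :
    toTorus (hd := hd) (hL := hL) (mV := mV) (KV := KV) (ℓ := ℓ) (x + e μ) = (toTorus x).shift μ := by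
  funext ν
  simp only [toTorus, Site.shift, Function.update_apply, Pi.add_apply, e_apply]
  split_ifs with h
  · subst h; push_cast; ring
  · simp

/-- **`−e_μ ↦ unshift`**: `toTorus (x − e_μ) = (toTorus x).unshift μ`. [cite: Balaban1984PropagatorsI, (1.21) p.21 («x − e_μ»), dictionary] -/
theorem toTorus_sub_e (x : Fin (d + 1) → ℤ) (μ : Fin (d + 1)) :
    toTorus (hd := hd) (hL := hL) (mV := mV) (KV := KV) (ℓ := ℓ) (x - e μ) = (toTorus x).unshift μ := by
  funext ν
  simp only [toTorus, Site.unshift, Function.update_apply, Pi.sub_apply, e_apply]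
  split_ifs with h
  · subst h; push_cast; ring
  · simp

/-- `shift` read on labels: `y.shift μ = toTorus (labels y + e_μ)`. [cite: Balaban1984PropagatorsI, (1.2) p.18, dictionary] -/
theorem shift_eq_toTorus (y : Site (PV d ℓ mV KV hd hL) 0) (μ : Fin (d + 1)) : y.shift μ = toTorus (labels y + e μ) := by
  rw [toTorus_add_e, toTorus_labels]

/-- `unshift` read on labels: `y.unshift μ = toTorus (labels y − e_μ)`. [cite: Balaban1984PropagatorsI, (1.21) p.21, dictionary] -/
theorem unshift_eq_toTorus (y : Site (PV d ℓ mV KV hd hL) 0) (μ : Fin (d + 1)) : y.unshift μ = toTorus (labels y - e μ) := by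
  rw [toTorus_sub_e, toTorus_labels]

end Chart

/-! ## §2 Deeply supported fields and the master translation lemma -/

section Deep

variable {V : Type*} [Zero V]

/-- **`r`-DEEP SUPPORT in the fundamental box** `Π_μ[0, N)`: wherever `f` is non-zero, every coordinate lies in `[r, N − r)` — a field of the cube member
zero-extended to `ℤ^{d+1}` has this property with a large `r` (the translated `□₀` is `ρLⁿ`-deep, `B8CubeMemberTorusDomainsL0.siteDeep_shift_of_mem_cube_zero`).
[cite: Balaban1984PropagatorsII, (2.36) p.229; Balaban1985RegularSpaces, p.98, dictionary] -/
def DeepSupp (N : ℕ) (r : ℤ) (f : (Fin (d + 1) → ℤ) → V) : Prop := ∀ z, f z ≠ 0 → ∀ μ, r ≤ z μ ∧ z μ + r < N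

/-- deepness of the support is monotone in the depth. [folklore] [cite: Balaban1984PropagatorsII, (2.36) p.229, dictionary] -/
theorem DeepSupp.mono {N : ℕ} {r r' : ℤ} {f : (Fin (d + 1) → ℤ) → V} (h : DeepSupp N r f) (hr : r' ≤ r) : DeepSupp N r' f :=
  fun z hz μ => ⟨hr.trans (h z hz μ).1, by linarith [(h z hz μ).2]⟩

/-- a deeply supported field vanishes at every point with a coordinate below `r` … [folklore] [cite: Balaban1984PropagatorsII, (2.36) p.229, dictionary] -/
theorem DeepSupp.eq_zero_of_lt {N : ℕ} {r : ℤ} {f : (Fin (d + 1) → ℤ) → V} (h : DeepSupp N r f) {z : Fin (d + 1) → ℤ} {μ : Fin (d + 1)}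
    (hz : z μ < r) : f z = 0 := by
  by_contra hne; exact absurd (h z hne μ).1 (not_le.mpr hz)

/-- … or with a coordinate `≥ N − r`. [folklore] [cite: Balaban1984PropagatorsII, (2.36) p.229, dictionary] -/
theorem DeepSupp.eq_zero_of_ge {N : ℕ} {r : ℤ} {f : (Fin (d + 1) → ℤ) → V} (h : DeepSupp N r f) {z : Fin (d + 1) → ℤ} {μ : Fin (d + 1)}
    (hz : (N : ℤ) ≤ z μ + r) : f z = 0 := by
  by_contra hne; exact absurd (h z hne μ).2 (not_lt.mpr hz)

/-- ★ **THE MASTER TRANSLATION LEMMA**: for `f` supported `r`-deep (`0 ≤ r ≤ N`) and a translation vector `v` with `|v_μ| ≤ r`, the value of `f` at the labels of the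
torus point `toTorus (labels y + v)` IS its value at `labels y + v` — if the translate leaves the fundamental box both sides vanish (the reduced point has a coordinate in
`[0, r) ∪ [N − r, N)`). [cite: Balaban1983RegularityDecay, p.572 (periodic conditions); Balaban1984PropagatorsII, (2.36) p.229, dictionary] -/
theorem apply_labels_toTorus_add {r : ℤ} (hr : 0 ≤ r) (hrN : r ≤ ((PV d ℓ mV KV hd hL).sitesPerDir 0 : ℕ)) {f : (Fin (d + 1) → ℤ) → V}
    (hf : DeepSupp ((PV d ℓ mV KV hd hL).sitesPerDir 0) r f) (y : Site (PV d ℓ mV KV hd hL) 0) {v : Fin (d + 1) → ℤ} (hv : ∀ μ, |v μ| ≤ r) :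
    f (labels (toTorus (hd := hd) (hL := hL) (mV := mV) (KV := KV) (ℓ := ℓ) (labels y + v))) = f (labels y + v) := by
  set N : ℕ := (PV d ℓ mV KV hd hL).sitesPerDir 0 with hNdef
  by_cases hin : ∀ μ, 0 ≤ (labels y + v) μ ∧ (labels y + v) μ < (N : ℤ)
  · rw [labels_toTorus hin]
  · push Not at hin
    obtain ⟨μ, hμ⟩ := hin
    have hy0 := labels_nonneg y μ
    have hyN := labels_lt y μ
    have hvμ := abs_le.mp (hv μ)
    -- the un-reduced translate is outside the box, hence outside the support
    have hR : f (labels y + v) = 0 := by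
      by_cases hneg : (labels y + v) μ < 0
      · exact hf.eq_zero_of_lt (lt_of_lt_of_le hneg hr)
      · have hge : (N : ℤ) ≤ (labels y + v) μ := hμ (not_lt.mp hneg)
        exact hf.eq_zero_of_ge (μ := μ) (by linarith)
    -- the reduced translate has its `μ`-coordinate in `[0, r) ∪ [N − r, N)`
    have hL : f (labels (toTorus (hd := hd) (hL := hL) (mV := mV) (KV := KV) (ℓ := ℓ) (labels y + v))) = 0 := by
      have hcoord := labels_toTorus_apply (hd := hd) (hL := hL) (mV := mV) (KV := KV) (ℓ := ℓ) (labels y + v) μ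
      by_cases hneg : (labels y + v) μ < 0
      · -- wrap from below: the reduced coordinate is `(labels y + v) μ + N ≥ N − r`
        have hw0 : 0 ≤ (labels y + v) μ + N := by simp only [Pi.add_apply] at hneg ⊢; linarith
        have hwN : (labels y + v) μ + N < N := by linarith
        have hmod : (labels y + v) μ % (N : ℤ) = (labels y + v) μ + N := by
          have key := Int.add_mul_emod_self_left ((labels y + v) μ + N) (N : ℤ) (-1)
          rw [Int.emod_eq_of_lt hw0 hwN] at key
          have e1 : (labels y + v) μ + (N : ℤ) + (N : ℤ) * -1 = (labels y + v) μ := by ring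
          rwa [e1] at key
        refine hf.eq_zero_of_ge (μ := μ) ?_
        rw [hcoord, hmod]
        simp only [Pi.add_apply] at hneg ⊢
        linarith
      · -- wrap from above: the reduced coordinate is `(labels y + v) μ − N < r`
        have hge : (N : ℤ) ≤ (labels y + v) μ := hμ (not_lt.mp hneg)
        have hw0 : 0 ≤ (labels y + v) μ - N := by linarith
        have hwN : (labels y + v) μ - N < N := by simp only [Pi.add_apply] at hge ⊢; linarith
        have hmod : (labels y + v) μ % (N : ℤ) = (labels y + v) μ - N := by
          have key := Int.add_mul_emod_self_left ((labels y + v) μ - N) (N : ℤ) 1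
          rw [Int.emod_eq_of_lt hw0 hwN] at key
          have e1 : (labels y + v) μ - (N : ℤ) + (N : ℤ) * 1 = (labels y + v) μ := by ring
          rwa [e1] at key
        refine hf.eq_zero_of_lt (μ := μ) ?_
        rw [hcoord, hmod]
        simp only [Pi.add_apply] at hge ⊢
        linarith
    rw [hL, hR]

/-- **ONE STEP FORWARD**: `f (labels (y.shift μ)) = f (labels y + e_μ)` for `f` supported `1`-deep. [cite: Balaban1984PropagatorsI, (1.2) p.18, dictionary] -/
theorem apply_labels_shift {r : ℤ} (hr : 1 ≤ r) (hrN : r ≤ ((PV d ℓ mV KV hd hL).sitesPerDir 0 : ℕ)) {f : (Fin (d + 1) → ℤ) → V}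
    (hf : DeepSupp ((PV d ℓ mV KV hd hL).sitesPerDir 0) r f) (y : Site (PV d ℓ mV KV hd hL) 0) (μ : Fin (d + 1)) :
    f (labels (y.shift μ)) = f (labels y + e μ) := by
  rw [shift_eq_toTorus]
  exact apply_labels_toTorus_add (by linarith) hrN hf y fun ν => by rw [e_apply]; split_ifs <;> simp <;> linarith

/-- **ONE STEP BACKWARD**: `f (labels (y.unshift μ)) = f (labels y − e_μ)` for `f` supported `1`-deep. [cite: Balaban1984PropagatorsI, (1.21) p.21, dictionary] -/
theorem apply_labels_unshift {r : ℤ} (hr : 1 ≤ r) (hrN : r ≤ ((PV d ℓ mV KV hd hL).sitesPerDir 0 : ℕ)) {f : (Fin (d + 1) → ℤ) → V}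
    (hf : DeepSupp ((PV d ℓ mV KV hd hL).sitesPerDir 0) r f) (y : Site (PV d ℓ mV KV hd hL) 0) (μ : Fin (d + 1)) :
    f (labels (y.unshift μ)) = f (labels y - e μ) := by
  rw [unshift_eq_toTorus, sub_eq_add_neg]
  exact apply_labels_toTorus_add (by linarith) hrN hf y fun ν => by
    rw [Pi.neg_apply, e_apply]; split_ifs <;> simp <;> linarith

/-- **TWO STEPS** `+e_μ + e_ν` for `f` supported `2`-deep. [cite: Balaban1984PropagatorsI, (1.2) p.18, dictionary] -/
theorem apply_labels_shift_shift {r : ℤ} (hr : 2 ≤ r) (hrN : r ≤ ((PV d ℓ mV KV hd hL).sitesPerDir 0 : ℕ)) {f : (Fin (d + 1) → ℤ) → V}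
    (hf : DeepSupp ((PV d ℓ mV KV hd hL).sitesPerDir 0) r f) (y : Site (PV d ℓ mV KV hd hL) 0) (μ ν : Fin (d + 1)) :
    f (labels ((y.shift μ).shift ν)) = f (labels y + e μ + e ν) := by
  have h1 : (y.shift μ).shift ν = toTorus (labels y + (e μ + e ν)) := by
    rw [shift_eq_toTorus y μ, ← toTorus_add_e, add_assoc]
  rw [h1, ← add_assoc]
  rw [show labels y + e μ + e ν = labels y + (e μ + e ν) from add_assoc _ _ _]
  exact apply_labels_toTorus_add (by linarith) hrN hf y fun κ => by
    rw [Pi.add_apply, e_apply, e_apply]; split_ifs <;> simp <;> linarith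

/-- **A STEP BACK AND A STEP FORWARD** `−e_ν + e_μ` for `f` supported `2`-deep. [cite: Balaban1984PropagatorsI, (1.21) p.21, dictionary] -/
theorem apply_labels_unshift_shift {r : ℤ} (hr : 2 ≤ r) (hrN : r ≤ ((PV d ℓ mV KV hd hL).sitesPerDir 0 : ℕ)) {f : (Fin (d + 1) → ℤ) → V}
    (hf : DeepSupp ((PV d ℓ mV KV hd hL).sitesPerDir 0) r f) (y : Site (PV d ℓ mV KV hd hL) 0) (μ ν : Fin (d + 1)) :
    f (labels ((y.unshift ν).shift μ)) = f (labels y - e ν + e μ) := by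
  have h1 : (y.unshift ν).shift μ = toTorus (labels y + (-e ν + e μ)) := by
    rw [unshift_eq_toTorus y ν, ← toTorus_add_e, sub_eq_add_neg, add_assoc]
  rw [h1, show labels y - e ν + e μ = labels y + (-e ν + e μ) by rw [sub_eq_add_neg, add_assoc]]
  exact apply_labels_toTorus_add (by linarith) hrN hf y fun κ => by
    rw [Pi.add_apply, Pi.neg_apply, e_apply, e_apply]; split_ifs <;> simp <;> linarith

/-- **DEEP SUPPORT PASSES TO STENCILS**: if `F w ≠ 0` forces `f (w + v) ≠ 0` for some `v` of sup-size `≤ s`, and `f` is `r`-deep, then `F` is `(r − s)`-deep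
(e.g. `D^η_1φ`, `Δ^η_1φ`, `J(φ)` are one or two units less deep than `φ`). [folklore] [cite: Balaban1984PropagatorsII, (2.36) p.229, dictionary] -/
theorem DeepSupp.of_stencil {W : Type*} [Zero W] {N : ℕ} {r s : ℤ} {f : (Fin (d + 1) → ℤ) → V} {F : (Fin (d + 1) → ℤ) → W}
    (hf : DeepSupp N r f) (hF : ∀ w, F w ≠ 0 → ∃ v : Fin (d + 1) → ℤ, (∀ κ, |v κ| ≤ s) ∧ f (w + v) ≠ 0) : DeepSupp N (r - s) F := by
  intro w hw κ
  obtain ⟨v, hv, hne⟩ := hF w hw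
  obtain ⟨h1, h2⟩ := hf (w + v) hne κ
  have hvκ := abs_le.mp (hv κ)
  simp only [Pi.add_apply] at h1 h2
  constructor <;> linarith

end Deep

/-! ## §3 Lifting a bond field of `ℤ^{d+1}` to the torus through a real functional, and the four operator identities at `U₀ = 1` -/

section Lift

/-- **THE LIFT OF A `ℂ`-VALUED BOND FIELD OF `ℤ^{d+1}` TO A REAL TORUS BOND FUNCTION** through a real-linear functional `g` (`re` or `im`): `b ↦ g(φ(labels b₋, dir b))`.
[cite: Balaban1984PropagatorsII, (2.19) p.226 (the real vector fields of Δ_a); Balaban1985RegularSpaces, p.86 (A complex∕𝔤-valued), dictionary] -/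
def liftB (g : ℂ →ₗ[ℝ] ℝ) (φ : (Fin (d + 1) → ℤ) → Fin (d + 1) → ℂ) : PBond (PV d ℓ mV KV hd hL) 0 → ℝ :=
  fun b => g (φ (labels b.src) b.dir)

/-- **THE LIFT OF A `ℂ`-VALUED SITE FIELD** `y ↦ g(f(labels y))`. [cite: Balaban1984PropagatorsII, (2.10) p.225, dictionary] -/
def liftS (g : ℂ →ₗ[ℝ] ℝ) (f : (Fin (d + 1) → ℤ) → ℂ) : Site (PV d ℓ mV KV hd hL) 0 → ℝ := fun y => g (f (labels y))

/-- unfolding `liftB`. [folklore] [cite: Balaban1984PropagatorsII, (2.19) p.226, dictionary] -/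
@[simp] theorem liftB_apply (g : ℂ →ₗ[ℝ] ℝ) (φ : (Fin (d + 1) → ℤ) → Fin (d + 1) → ℂ) (b : PBond (PV d ℓ mV KV hd hL) 0) :
    liftB g φ b = g (φ (labels b.src) b.dir) := rfl

/-- unfolding `liftS`. [folklore] [cite: Balaban1984PropagatorsII, (2.10) p.225, dictionary] -/
@[simp] theorem liftS_apply (g : ℂ →ₗ[ℝ] ℝ) (f : (Fin (d + 1) → ℤ) → ℂ) (y : Site (PV d ℓ mV KV hd hL) 0) :
    liftS g f y = g (f (labels y)) := rfl

/-- `g` is real-linear: `g (a • z) = a * g z` for real `a`. [folklore] [cite: Balaban1984PropagatorsII, (2.19) p.226, dictionary] -/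
private theorem g_smul (g : ℂ →ₗ[ℝ] ℝ) (a : ℝ) (z : ℂ) : g (a • z) = a * g z := by
  rw [g.map_smul, smul_eq_mul]

variable {η : ℝ}

/-- ★ **`∇^η_ν` ON THE TORUS IS `D^η_{1,ν}` ON `ℤ^{d+1}`** (componentwise, `c = η⁻¹`): for `φ` supported `1`-deep, `(∇_ν liftB g φ)(⟨x, τ⟩) = g((D^η_{1,ν}φ_τ)(labels x))`.
[cite: Balaban1985RegularSpaces, (1.1) p.76; Balaban1984PropagatorsI, (1.4) p.18; Balaban1984PropagatorsII, Prop. 2.6 (2.136) p.247 (the ∇ member)] -/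
theorem DV_liftB {r : ℤ} (hr : 1 ≤ r) (hrN : r ≤ ((PV d ℓ mV KV hd hL).sitesPerDir 0 : ℕ)) (g : ℂ →ₗ[ℝ] ℝ)
    {φ : (Fin (d + 1) → ℤ) → Fin (d + 1) → ℂ} (hφ : DeepSupp ((PV d ℓ mV KV hd hL).sitesPerDir 0) r φ)
    (ν : Fin (d + 1)) (b : PBond (PV d ℓ mV KV hd hL) 0) :
    DV ν η⁻¹ (liftB g φ) b = g (covDerivFwd η (1 : (Fin (d + 1) → ℤ) → Fin (d + 1) → ℂˣ) ν (fun z => φ z b.dir) (labels b.src)) := by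
  rw [DV_apply, liftB_apply, liftB_apply, covDerivFwd_flat_apply, g_smul, map_sub]
  have h := congrFun (apply_labels_shift hr hrN hφ b.src ν) b.dir
  rw [h]

/-- ★ **THE CURL `∂` ON THE TORUS IS THE PLAQUETTE DERIVATIVE `D^η_1` OF [B9] (3.4) ON `ℤ^{d+1}`** (`c = η⁻¹`): for `φ` supported `1`-deep,
`(∂ liftB g φ)(p_{μν}(x)) = g((D^η_1φ)(p_{μν}(labels x)))` — the same four-term stencil `A(x,μ) + A(x+e_μ,ν) − A(x+e_ν,μ) − A(x,ν)`.
[cite: Balaban1984PropagatorsI, (1.2) p.18; Balaban1985BackgroundPropagators, (3.4) p.391; Balaban1985RegularSpaces, (1.55) p.86] -/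
theorem curl_liftB {r : ℤ} (hr : 1 ≤ r) (hrN : r ≤ ((PV d ℓ mV KV hd hL).sitesPerDir 0 : ℕ)) (g : ℂ →ₗ[ℝ] ℝ)
    {φ : (Fin (d + 1) → ℤ) → Fin (d + 1) → ℂ} (hφ : DeepSupp ((PV d ℓ mV KV hd hL).sitesPerDir 0) r φ)
    (p : Plaq (PV d ℓ mV KV hd hL) 0) :
    curl η⁻¹ (liftB g φ) p = g (plaqCovDeriv η (1 : (Fin (d + 1) → ℤ) → Fin (d + 1) → ℂˣ) φ p.μ p.ν (labels p.src)) := by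
  simp only [curl, liftB_apply, plaqCovDeriv, B8Eq146AExpansion.lin, B8Eq146AExpansion.X1, B8Eq146AExpansion.X2,
    B8Eq146AExpansion.X3, B8Eq146AExpansion.X4, Pi.one_apply, B8Eq191FlatStencils.conjR_unitOne, g_smul, map_add, map_neg]
  have h1 := congrFun (apply_labels_shift hr hrN hφ p.src p.μ) p.ν
  have h2 := congrFun (apply_labels_shift hr hrN hφ p.src p.ν) p.μ
  rw [h1, h2]
  ring

/-- ★ **THE LAPLACIAN `Δ` ON THE TORUS IS THE FLAT `Δ^η_1` OF [4] (3.23) ON `ℤ^{d+1}`** (componentwise, `c = η⁻¹`): for `φ` supported `1`-deep,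
`(Δ (liftB g φ)_τ)(x) = g((Δ^η_1φ_τ)(labels x))` — both are `Σ_μ η⁻²(2f(x) − f(x+e_μ) − f(x−e_μ))`.
[cite: Balaban1984PropagatorsI, (1.21) p.21; Balaban1985BackgroundPropagators, (3.23) p.394; Balaban1985RegularSpaces, (1.59) p.86 (the Δ member)] -/
theorem laplace_liftB {r : ℤ} (hr : 1 ≤ r) (hrN : r ≤ ((PV d ℓ mV KV hd hL).sitesPerDir 0 : ℕ)) (g : ℂ →ₗ[ℝ] ℝ)
    {φ : (Fin (d + 1) → ℤ) → Fin (d + 1) → ℂ} (hφ : DeepSupp ((PV d ℓ mV KV hd hL).sitesPerDir 0) r φ)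
    (τ : Fin (d + 1)) (x : Site (PV d ℓ mV KV hd hL) 0) :
    laplace η⁻¹ (fun z => liftB g φ ⟨z, τ⟩) x = g (covLap η (1 : (Fin (d + 1) → ℤ) → Fin (d + 1) → ℂˣ) (fun z => φ z τ) (labels x)) := by
  rw [covLap_flat_apply, map_sum]
  unfold laplace
  refine Finset.sum_congr rfl fun μ _ => ?_
  simp only [liftB_apply]
  have h1 := congrFun (apply_labels_shift hr hrN hφ x μ) τ
  have h2 := congrFun (apply_labels_unshift hr hrN hφ x μ) τ
  rw [h1, h2]
  simp only [g_smul, map_sub, smul_eq_mul, inv_pow]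
  ring

/-- `Σ_{ν ∈ Iio μ} = Σ_ν 𝟙(ν < μ)·` (private plumbing). [folklore] -/
private theorem sum_Iio_eq_sum_ite {M : Type*} [AddCommMonoid M] (μ : Fin (d + 1)) (G : Fin (d + 1) → M) :
    ∑ ν ∈ Finset.Iio μ, G ν = ∑ ν, if ν < μ then G ν else 0 := by
  rw [← Finset.sum_filter]
  congr 1
  ext ν
  simp

/-- `Σ_{ν ∈ Ioi μ} = Σ_ν 𝟙(μ < ν)·` (private plumbing). [folklore] -/
private theorem sum_Ioi_eq_sum_ite {M : Type*} [AddCommMonoid M] (μ : Fin (d + 1)) (G : Fin (d + 1) → M) :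
    ∑ ν ∈ Finset.Ioi μ, G ν = ∑ ν, if μ < ν then G ν else 0 := by
  rw [← Finset.sum_filter]
  congr 1
  ext ν
  simp

/-- the plaquette derivative of a deeply supported field is supported one unit less deep. [folklore] [cite: Balaban1985BackgroundPropagators, (3.4) p.391, dictionary] -/
theorem deepSupp_plaqCovDeriv {N : ℕ} {r : ℤ} {φ : (Fin (d + 1) → ℤ) → Fin (d + 1) → ℂ} (hφ : DeepSupp N r φ) (η : ℝ) (μ ν : Fin (d + 1)) :
    DeepSupp N (r - 1) (fun w => plaqCovDeriv η (1 : (Fin (d + 1) → ℤ) → Fin (d + 1) → ℂˣ) φ μ ν w) := by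
  refine hφ.of_stencil fun w hw => ?_
  by_contra hall
  push Not at hall
  have h0 : φ w = 0 := by
    have := hall 0 (fun κ => by simp)
    rwa [add_zero] at this
  have hμ : φ (w + e μ) = 0 := hall (e μ) (fun κ => by rw [e_apply]; split_ifs <;> simp)
  have hν : φ (w + e ν) = 0 := hall (e ν) (fun κ => by rw [e_apply]; split_ifs <;> simp)
  apply hw
  simp only [plaqCovDeriv, B8Eq146AExpansion.lin, B8Eq146AExpansion.X1, B8Eq146AExpansion.X2, B8Eq146AExpansion.X3, B8Eq146AExpansion.X4,
    Pi.one_apply, B8Eq191FlatStencils.conjR_unitOne, h0, hμ, hν, Pi.zero_apply, neg_zero, add_zero, smul_zero]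

/-- ★★ **`∂*∂` ON THE TORUS IS `J = D^{η*}_1D^η_1` OF (1.55) ON `ℤ^{d+1}`** (`c = η⁻¹`): for `φ` supported `2`-deep,
`(∂*∂ liftB g φ)(⟨x, μ⟩) = g(J(φ)_μ(labels x))` — (1.2) «(D^{η*}F)_μ(x) = Σ_{ν<μ}(D^{η*}_νF_{νμ})(x) − Σ_{ν>μ}(D^{η*}_νF_{μν})(x)» applied to `F = D^η_1φ` on both sides
(`B8Eq12HodgeLaplacianV1.dcsE_apply`, `B8Eq143PlaqExpansion.pdiv`). [cite: Balaban1985RegularSpaces, (1.2) p.76, (1.55) p.86; Balaban1984PropagatorsII, (2.19) p.226 («∂*∂»)] -/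
theorem dcsE_dcE_liftB {r : ℤ} (hr : 2 ≤ r) (hrN : r ≤ ((PV d ℓ mV KV hd hL).sitesPerDir 0 : ℕ)) (g : ℂ →ₗ[ℝ] ℝ)
    {φ : (Fin (d + 1) → ℤ) → Fin (d + 1) → ℂ} (hφ : DeepSupp ((PV d ℓ mV KV hd hL).sitesPerDir 0) r φ)
    (b : PBond (PV d ℓ mV KV hd hL) 0) :
    dcsE η⁻¹ (dcE η⁻¹ (WithLp.toLp 2 (liftB g φ))) b = g (Jcur η (1 : (Fin (d + 1) → ℤ) → Fin (d + 1) → ℂˣ) φ b.dir (labels b.src)) := by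
  have hr1 : 1 ≤ r := by linarith
  have hr1' : (1 : ℤ) ≤ r - 1 := by linarith
  have hrN' : r - 1 ≤ ((PV d ℓ mV KV hd hL).sitesPerDir 0 : ℕ) := by linarith
  rw [dcsE_apply, B8Eq155JBound.Jcur_def, B8Eq143PlaqExpansion.pdiv, map_sub, map_sum, map_sum, sum_Iio_eq_sum_ite, sum_Ioi_eq_sum_ite]
  congr 1
  · refine Finset.sum_congr rfl fun ν _ => ?_
    split_ifs with h
    · simp only [pdiffAdj, dcE_apply, curl_liftB hr1 hrN g hφ, covDeriv_flat_apply, g_smul, map_sub, smul_eq_mul]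
      have hst := deepSupp_plaqCovDeriv hφ η ν b.dir
      rw [apply_labels_unshift hr1' hrN' hst b.src ν]
    · simp
  · refine Finset.sum_congr rfl fun ν _ => ?_
    split_ifs with h
    · simp only [pdiffAdj, dcE_apply, curl_liftB hr1 hrN g hφ, covDeriv_flat_apply, g_smul, map_sub, smul_eq_mul]
      have hst := deepSupp_plaqCovDeriv hφ η b.dir ν
      rw [apply_labels_unshift hr1' hrN' hst b.src ν]
    · simp

/-- ★ **THE DIVERGENCE `∂*` ON THE TORUS IS `D^{η*}_1` ON `ℤ^{d+1}`** (`c = η⁻¹`): for `φ` supported `1`-deep, `(∂* liftB g φ)(x) = g((D^{η*}_1φ)(labels x))` — both are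
`Σ_μ η⁻¹(A(x − e_μ, μ) − A(x, μ))` ((1.21) of [B5] ∕ (1.1)₂ of [B8]). [cite: Balaban1984PropagatorsI, (1.21) p.21; Balaban1985RegularSpaces, (1.1) p.76, (1.38) p.82] -/
theorem diverg_liftB {r : ℤ} (hr : 1 ≤ r) (hrN : r ≤ ((PV d ℓ mV KV hd hL).sitesPerDir 0 : ℕ)) (g : ℂ →ₗ[ℝ] ℝ)
    {φ : (Fin (d + 1) → ℤ) → Fin (d + 1) → ℂ} (hφ : DeepSupp ((PV d ℓ mV KV hd hL).sitesPerDir 0) r φ)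
    (x : Site (PV d ℓ mV KV hd hL) 0) :
    LatticeFieldCalculus.diverg η⁻¹ (liftB g φ) x = g (covDivB η (1 : (Fin (d + 1) → ℤ) → Fin (d + 1) → ℂˣ) φ (labels x)) := by
  unfold LatticeFieldCalculus.diverg covDivB
  rw [map_sum]
  refine Finset.sum_congr rfl fun μ _ => ?_
  simp only [liftB_apply, covDeriv_flat_apply, g_smul, map_sub, smul_eq_mul]
  have h := congrFun (apply_labels_unshift hr hrN hφ x μ) μ
  rw [h]

/-- ★ **THE LAPLACIAN ON SITE FUNCTIONS**: for a `ℂ`-valued site function `f` of `ℤ^{d+1}` supported `1`-deep, `(Δ liftS g f)(x) = g((Δ^η_1 f)(labels x))` (`c = η⁻¹`) —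
the scalar `Δ` of [B6] (2.10)–(2.12) on the gauge functions. [cite: Balaban1984PropagatorsI, (1.21) p.21; Balaban1984PropagatorsII, (2.10)–(2.12) p.225; Balaban1985BackgroundPropagators, (3.23) p.394] -/
theorem laplace_liftS {r : ℤ} (hr : 1 ≤ r) (hrN : r ≤ ((PV d ℓ mV KV hd hL).sitesPerDir 0 : ℕ)) (g : ℂ →ₗ[ℝ] ℝ)
    {f : (Fin (d + 1) → ℤ) → ℂ} (hf : DeepSupp ((PV d ℓ mV KV hd hL).sitesPerDir 0) r f) (x : Site (PV d ℓ mV KV hd hL) 0) :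
    laplace η⁻¹ (liftS g f) x = g (covLap η (1 : (Fin (d + 1) → ℤ) → Fin (d + 1) → ℂˣ) f (labels x)) := by
  rw [covLap_flat_apply, map_sum]
  unfold laplace
  refine Finset.sum_congr rfl fun μ _ => ?_
  simp only [liftS_apply]
  rw [apply_labels_shift hr hrN hf x μ, apply_labels_unshift hr hrN hf x μ]
  simp only [g_smul, map_sub, smul_eq_mul, inv_pow]
  ring

end Lift

end Literature.MathematicalPhysics.QuantumFieldTheory.Balaban1983to89.B8CubeMemberTorusChart
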